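import Mathlib
import Literature.Combinatorics.Optimization.CorrelationPolytopeGridMinor
import Literature.Computability.MetaComplexity.GridTseitinLift
import Summits.ValiantsHypothesis.ValiantsHypothesis.Theorems.FifoMatchingNFPolytopeQueueGridPPHardOfCorGridMinor
import HarnessLib

/-!
# T1 — shadows of the pair-pattern polytope `PP_r` pull back from shadows of `COR(G_{⌊r/2⌋})` along c1's read-out
# `corMap` — Theorems-side port, def-free

Port to `Theorems/` (director-valiant g12 R180 (b)(i), val-lit desk #270 (c): val-port-2 = S-port hand) of T1
`ppShadow_of_grid` of val-idea-7 g7's kernel-checked line workfile `Cruxes/NNLinearDegreeCofactorHard/Lines/shadow_division.lean`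
rev 5b, verbatim body, with the line's σ-currency `GridCorShadowHard` / `PPShadowHard` / `shadowVerts` / `T` UNFOLDED in
hypothesis and conclusion (crit-3 #21b port note (a): no fresh `Prop` defs Theorems-side), so that the line file takes it as
`ppShadow_of_grid hG := GridCorShadow.ppShadow_of_grid hG` by plain definitional unfolding.

Content: shadows pull back VERBATIM along c1's PROVED linear read-out `corMap r ⌊r/2⌋ : PP_r ↠ COR(G_{⌊r/2⌋})`
(`QueueGridFace.range_corMap_patternVec`, p615220, consumed by name; bridge `QueueGridFace.corVec_eq_corVertex` between the
Literature `corVec` and c1's `corVertex`): `(L ∘ corMap) '' range (patternVec r) = L '' range (corVec (gridGraph ⌊r/2⌋))` is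
the same planar point set, hence the same polygon; the threshold shifts by one in the exponent parameter,
`(log₂ r + c)^c ≤ (log₂ ⌊r/2⌋ + (c+1))^{c+1}` for `r ≥ 2`.  So: if for every `c` eventually some planar shadow of the
vertex set of `COR(G_{t,t})` has `> 2^((log₂ t + c)^c)` vertices (G, e.g. from G♭ by `gridCorShadowHard_of_cliqueFace`),
then for every `c` eventually some planar shadow of `range (patternVec r)` has `> 2^((log₂ r + c)^c)` vertices.

HONEST FRAMING: a transfer inside an OPEN line (inputs A1 `QueueGridZeroOnePoints` and G♭ = stmt-27045 OPEN; K1 stmt-26254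
closed only conditionally); no rung of record moves; nothing here bears on `VP ≠ VNP`, which is NOT proved.
-/

set_option autoImplicit false

-- the mandated summit-side namespace repeats a component by design (single-problem summit)
set_option linter.dupNamespace false

namespace Summit.ValiantsHypothesis.ValiantsHypothesis.Theorems.FifoMatching

namespace GridCorShadow

open Literature.Combinatorics.Optimization (corVec)
open Literature.Computability.MetaComplexity (gridGraph)
open Summit.ValiantsHypothesis.ValiantsHypothesis.Theorems.FifoMatching.QueueGridFace
  (QGV patternVec corVertex corMap range_corMap_patternVec corVec_eq_corVertex)

/-- **T1** — shadows of `PP_r = conv(range (patternVec r))` pull back from shadows of the vertex set of `COR(G_{⌊r/2⌋})`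
along c1's linear read-out `corMap r ⌊r/2⌋` (same polygon), with the threshold shift `c ↦ c + 1`:
G (`GridCorShadowHard`, unfolded) ⟹ `PPShadowHard` (unfolded). -/
theorem ppShadow_of_grid
    (hG : ∀ c : ℕ, ∃ t₀ : ℕ, ∀ t ≥ t₀, ∃ L : ((Fin (t * t) × Fin (t * t)) → ℝ) →ₗ[ℝ] (Fin 2 → ℝ),
      2 ^ ((Nat.log 2 t + c) ^ c) <
        (Set.extremePoints ℝ (convexHull ℝ (L '' Set.range (corVec (gridGraph t))))).ncard) :
    ∀ c : ℕ, ∃ r₀ : ℕ, ∀ r ≥ r₀, ∃ Λ : (((QGV r × QGV r) × Bool × Bool) → ℝ) →ₗ[ℝ] (Fin 2 → ℝ),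
      2 ^ ((Nat.log 2 r + c) ^ c) <
        (Set.extremePoints ℝ (convexHull ℝ (Λ '' Set.range (patternVec r)))).ncard := by
  intro c
  obtain ⟨t₀, ht₀⟩ := hG (c + 1)
  refine ⟨2 * t₀ + 2, fun r hr => ?_⟩
  have hg : 2 * (r / 2) ≤ r := Nat.mul_div_le r 2
  have hgt : t₀ ≤ r / 2 := by omega
  obtain ⟨L, hL⟩ := ht₀ (r / 2) hgt
  refine ⟨L ∘ₗ corMap r (r / 2) hg, ?_⟩
  have hcv : Set.range (corVec (gridGraph (r / 2))) = Set.range (corVertex (gridGraph (r / 2))) :=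
    congrArg Set.range (funext (corVec_eq_corVertex (gridGraph (r / 2))))
  have himg : (L ∘ₗ corMap r (r / 2) hg) '' Set.range (patternVec r) =
      L '' Set.range (corVec (gridGraph (r / 2))) := by
    rw [hcv, LinearMap.coe_comp, Set.image_comp, ← Set.range_comp,
      show Set.range (⇑(corMap r (r / 2) hg) ∘ patternVec r) = Set.range (corVertex (gridGraph (r / 2))) from
        range_corMap_patternVec r (r / 2) hg]
  rw [himg]
  refine lt_of_le_of_lt ?_ hL
  -- threshold shift: `2^((log₂ r + c)^c) ≤ 2^((log₂ ⌊r/2⌋ + (c+1))^(c+1))`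
  have hlog : Nat.log 2 (r / 2) = Nat.log 2 r - 1 := Nat.log_div_base 2 r
  have hℓ1 : 1 ≤ Nat.log 2 r := Nat.log_pos (by norm_num) (by omega)
  apply Nat.pow_le_pow_right Nat.two_pos
  rw [hlog]
  calc (Nat.log 2 r + c) ^ c ≤ (Nat.log 2 r - 1 + (c + 1)) ^ c :=
        Nat.pow_le_pow_left (by omega) c
    _ ≤ (Nat.log 2 r - 1 + (c + 1)) ^ (c + 1) := Nat.pow_le_pow_right (by omega) (by omega)

end GridCorShadow

end Summit.ValiantsHypothesis.ValiantsHypothesis.Theorems.FifoMatching
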